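import Summits.Langlands.Langlands.Theses.LieDefectSplit
import Summits.Langlands.Langlands.Theorems.LieDefectSplit

/-!
# LieDefectSplit — bridge module (tree twin, PART 2: the BORN route's items ≡ the structured cells of PART 1)

PART 1 (`Theorems/LieDefectSplit.lean`, ns `…Theorems.CoreAdequacy.LieDefect`) carries §1–§5 of the decomp-langlands lens-5 gen-12 node
`LieDefectSplit` (nodes/lens-5-g12-LieDefectSplit.lean 0f5c83370f5e; crit-1 CLEARED row 208).  The node's §6 stated the child-route ONE-LINERS
under a scratch namespace and certified them identical to the structured cells by `Iff.rfl`; the route is now BORN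
(route-Langlands-LieDefectSplit rev 0 @b90edff92738, ROUTE-BORN L1049: LIE `LieObstructedLifting` stmt-Langlands-28415 · DEG
`DegenerateLayerLifting` 28416 · TRANS↓ `SolvableDescentTransport` 28417 · FRAME′ `NoAdequateLayerFrame` 28418 · Assembly 28419 · dedup OW 28903 ·
TOA 28874 · W⁺ 17415 · AUT↑ 27679 · CSD 31695 · AIL 27953 · TRANS 27955), so this file states the identities DIRECTLY ON THE LEDGER DECLARATIONS
`Summit.Langlands.Langlands.Theses.LieDefectSplit.*` (critic precedent row 188 e3 / row 198 k3): every route item ↔ the corresponding structured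
cell or parent decl by `Iff.rfl`, the EXACT cut `CoreAdequacySplit.NoAdequateLayerLifting ↔ LIE ∧ DEG ∧ SBL↓` read on the route decls, and the
route's deciding theorem recovered from PART 1's `closes_framed`.  Nothing here proves `Langlands` (rung 0).
-/

set_option linter.dupNamespace false

namespace Summit.Langlands.Langlands.Theorems.LieDefectBridge

open Summit.Langlands.Langlands.Theses
open Summit.Langlands.Langlands.Theorems.CoreAdequacy

/-! ## Route items ≡ structured cells (all `Iff.rfl`) -/

/-- LIE (stmt-Langlands-28415) is PART 1's structured `LieDefect.LieObstructedLifting`. -/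
theorem lie_route_iff : LieDefectSplit.LieObstructedLifting ↔ LieDefect.LieObstructedLifting := Iff.rfl

/-- DEG (stmt-Langlands-28416) is PART 1's structured `LieDefect.DegenerateLayerLifting`. -/
theorem deg_route_iff : LieDefectSplit.DegenerateLayerLifting ↔ LieDefect.DegenerateLayerLifting := Iff.rfl

/-- TRANS↓ (stmt-Langlands-28417) is PART 1's structured `LieDefect.SolvableDescentTransport`. -/
theorem transport_route_iff : LieDefectSplit.SolvableDescentTransport ↔ LieDefect.SolvableDescentTransport := Iff.rfl

/-- FRAME′ (stmt-Langlands-28418) is PART 1's `LieDefect.NoAdequateLayerFrame` (`RSL → Langlands`). -/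
theorem frame_route_iff : LieDefectSplit.NoAdequateLayerFrame ↔ LieDefect.NoAdequateLayerFrame := Iff.rfl

/-- dedup OW (stmt-Langlands-28903): the route's copy is the parent decl `CoreAdequacySplit.OdlyzkoWorldAutomorphy`. -/
theorem ow_route_iff : LieDefectSplit.OdlyzkoWorldAutomorphy ↔ CoreAdequacySplit.OdlyzkoWorldAutomorphy := Iff.rfl

/-- dedup TOA (stmt-Langlands-28874): the route's copy is `CoreAdequacySplit.TransOdlyzkoAutomorphy`. -/
theorem toa_route_iff : LieDefectSplit.TransOdlyzkoAutomorphy ↔ CoreAdequacySplit.TransOdlyzkoAutomorphy := Iff.rfl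

/-- dedup W⁺ (stmt-Langlands-17415): the route's copy is `CoreAdequacySplit.SatakeAvatarExistence`. -/
theorem wplus_route_iff : LieDefectSplit.SatakeAvatarExistence ↔ CoreAdequacySplit.SatakeAvatarExistence := Iff.rfl

/-- dedup AUT↑ (stmt-Langlands-27679): the route's copy is `CoreAdequacySplit.SolvableAscentConstituent`. -/
theorem up_route_iff : LieDefectSplit.SolvableAscentConstituent ↔ CoreAdequacySplit.SolvableAscentConstituent := Iff.rfl

/-- dedup CSD (stmt-Langlands-31695): the route's copy is `CoreAdequacySplit.CliffordSolvableDescent`. -/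
theorem csd_route_iff : LieDefectSplit.CliffordSolvableDescent ↔ CoreAdequacySplit.CliffordSolvableDescent := Iff.rfl

/-- dedup AIL (stmt-Langlands-27953): the route's copy is `CoreAdequacySplit.AdequateImageLifting`. -/
theorem ail_route_iff : LieDefectSplit.AdequateImageLifting ↔ CoreAdequacySplit.AdequateImageLifting := Iff.rfl

/-- dedup TRANS (stmt-Langlands-27955): the route's copy is `CoreAdequacySplit.SolvableAdequacyTransport`. -/
theorem trans_route_iff : LieDefectSplit.SolvableAdequacyTransport ↔ CoreAdequacySplit.SolvableAdequacyTransport := Iff.rfl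

/-! ## The exact cut and the glue, read on the route declarations -/

/-- EXACT CUT on the ledger decls: RSL (stmt-Langlands-27954) ⟺ LIE (28415) ∧ DEG (28416) ∧ SBL↓ (the bridge cell, not an item) —
PART 1's `NoAdequateLayerLifting_route_iff_cells` transported along the `Iff.rfl` identities. -/
theorem rsl_iff_route_cells :
    CoreAdequacySplit.NoAdequateLayerLifting ↔
      LieDefectSplit.LieObstructedLifting ∧ LieDefectSplit.DegenerateLayerLifting ∧ LieDefect.DescentShadowLifting :=
  LieDefect.NoAdequateLayerLifting_route_iff_cells

/-- SBL↓ from the route's TRANS↓ (28417) and the route's copies of the parent's seven binders (PART 1 `shadow_of_transport`). -/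
theorem shadow_of_route_transport (hTd : LieDefectSplit.SolvableDescentTransport) (h0 : LieDefectSplit.OdlyzkoWorldAutomorphy)
    (h1 : LieDefectSplit.TransOdlyzkoAutomorphy) (hW : LieDefectSplit.SatakeAvatarExistence) (hUp : LieDefectSplit.SolvableAscentConstituent)
    (hDown : LieDefectSplit.CliffordSolvableDescent) (hA : LieDefectSplit.AdequateImageLifting) (hT : LieDefectSplit.SolvableAdequacyTransport) :
    LieDefect.DescentShadowLifting :=
  hTd h0 h1 hW hUp hDown hA hT

/-- RSL (the parent's declared residual) from the route's LIE, DEG, TRANS↓ and the seven dedup binders. -/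
theorem rsl_of_route_items (hL : LieDefectSplit.LieObstructedLifting) (hD : LieDefectSplit.DegenerateLayerLifting)
    (hTd : LieDefectSplit.SolvableDescentTransport) (h0 : LieDefectSplit.OdlyzkoWorldAutomorphy) (h1 : LieDefectSplit.TransOdlyzkoAutomorphy)
    (hW : LieDefectSplit.SatakeAvatarExistence) (hUp : LieDefectSplit.SolvableAscentConstituent) (hDown : LieDefectSplit.CliffordSolvableDescent)
    (hA : LieDefectSplit.AdequateImageLifting) (hT : LieDefectSplit.SolvableAdequacyTransport) :
    CoreAdequacySplit.NoAdequateLayerLifting :=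
  rsl_iff_route_cells.2 ⟨hL, hD, shadow_of_route_transport hTd h0 h1 hW hUp hDown hA hT⟩

/- The route's deciding theorem `LieDefectSplit.closes` IS PART 1's `LieDefect.closes_framed` (glue ab5d4ed9ebf0 verbatim, 11 binders, same order). -/

/-! ## Necessity on the route declarations: every NEW item is `Langlands`-implied (PART 1 `Cert.*` transported) -/

/-- S ⟹ LIE (28415). -/
theorem lie_of_langlands (hS : _root_.Langlands) : LieDefectSplit.LieObstructedLifting := LieDefect.Cert.lie_of_langlands hS
/-- S ⟹ DEG (28416). -/
theorem deg_of_langlands (hS : _root_.Langlands) : LieDefectSplit.DegenerateLayerLifting := LieDefect.Cert.deg_of_langlands hS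
/-- S ⟹ TRANS↓ (28417). -/
theorem transport_of_langlands (hS : _root_.Langlands) : LieDefectSplit.SolvableDescentTransport := LieDefect.Cert.transport_of_langlands hS
/-- S ⟹ FRAME′ (28418). -/
theorem frame_of_langlands (hS : _root_.Langlands) : LieDefectSplit.NoAdequateLayerFrame := LieDefect.Cert.frame_of_langlands hS
/-- RSL ⟹ LIE on the route decls (LIE is a sub-box of the residual it refines). -/
theorem lie_of_rsl (h : CoreAdequacySplit.NoAdequateLayerLifting) : LieDefectSplit.LieObstructedLifting := LieDefect.Cert.lie_of_rsl h
/-- RSL ⟹ DEG on the route decls. -/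
theorem deg_of_rsl (h : CoreAdequacySplit.NoAdequateLayerLifting) : LieDefectSplit.DegenerateLayerLifting := LieDefect.Cert.deg_of_rsl h

end Summit.Langlands.Langlands.Theorems.LieDefectBridge
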